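import Mathlib.NumberTheory.Padics.Hensel
import Mathlib.NumberTheory.Padics.RingHoms
import Literature.NumberTheory.QuadraticForms.HilbertSymbolRatOdd
import Literature.NumberTheory.QuadraticForms.HilbertSymbolRatArchimedean
import HarnessLib

/-!
# Hilbert reciprocity over `ℚ` (the `2`-adic symbol and the assembly)

Topic `NumberTheory/QuadraticForms`; namespaces `Literature.Dyadic` and `Literature`; every declaration is a
fully proved theorem (or a definition with body). This file completes the proof of **Hilbert's
reciprocity law over `ℚ`** (Hilbert 1897; Serre, *A Course in Arithmetic*, Ch. III §2.1 Thm. 3):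

  `hilbertReciprocity_rat : ∀ a b : ℚ, hilbertReciprocity ℚ a b`

— the named fact of `HilbertSymbol.lean` (O'Meara 71:18) discharged for `K = ℚ`: for
`a b ∈ ℚ×` the Hilbert symbol `(a, b)_v` (computed in the completions `ℚ_v`, `v` finite or
infinite) is `-1` at finitely many places, even in number. Inputs:

* `Dyadic.*` — **Serre III §1.2 Thm. 1 for `p = 2`**, for non-zero integers:
  `(2^α u, 2^β w)_2 = (-1)^{ε(u)ε(w) + α ω(w) + β ω(u)} = localSignTwo a b`
  (`hilbertSymbol_padic_eq_localSignTwo`, in `ℚ_[2]`; `hilbertSymbol_rat_eq_localSignTwo` at the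
  place of `ℚ` over `2` via Mathlib's `adicCompletion.padicEquiv`). Proof as in Serre: units
  `≡ 1 (mod 8)` are squares in `ℤ_2` (`isSquare_of_toZModPow_three_eq_one`, Mathlib
  `hensels_lemma` for `X² - u`; Serre II §3.3 Thm. 4), so `(A, B)_2 = 1` as soon as
  `A x₀² + B y₀² ≡ 1 (mod 8)` has a solution (`hilbertSymbol_padic_eq_one_of_witness`), while
  congruence obstructions mod `8` and mod `4` propagate by descent from `A X² + B Y² = 4ⁿ`
  (`hilbertSymbol_padic_eq_neg_one_of_mod`); the rules `(u, w)_2 = (-1)^{ε(u)ε(w)}`,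
  `(2u, w)_2 = (-1)^{ε(u)ε(w)+ω(w)}`, `(2u, 2w)_2 = (2u, -uw)_2` then follow by the sixteen
  residue cases of `u, w (mod 8)` (`decide`).
* `HilbertSymbolRatOdd` (odd primes), `HilbertSymbolRatArchimedean` (`v = ∞`),
  `HilbertSymbolRatSigns.totalSign_eq_one` (product formula for the explicit signs: quadratic
  reciprocity and supplements), `HilbertReciprocityFiniteness` (finiteness).

Assembly (`hilbertReciprocity_rat`): reduce to non-zero integers (square classes), identify the
finite places with symbol `-1` with the primes `p ∣ 2ab` of explicit sign `-1`
(`ncard_setOf_hilbertSymbol_finite_rat`), the infinite one with `[a, b < 0]`, and read off the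
parity from the product formula. Consequence (with
`Automorphic/QuaternionRamificationParity.even_card_ramified_of_hilbertReciprocity`): the named
fact `even_card_ramified ℚ D` — a rational quaternion algebra is ramified at an even number of
places — holds.

## References

* J.-P. Serre, *A Course in Arithmetic*, GTM 7, Springer (1973), Ch. II §3.3 Thm. 4; Ch. III
  §1.2 Thm. 1, §2.1 Thm. 3 (PDF pp. 20–23).
* D. Hilbert, *Die Theorie der algebraischen Zahlkörper* (Zahlbericht), 1897.
* O. T. O'Meara, *Introduction to quadratic forms* (1963), Thm. 71:18.
-/



noncomputable section

open Polynomial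

namespace Literature.NumberTheory.QuadraticForms

namespace Dyadic

variable {p : ℕ} [hp2 : Fact p.Prime]

/-! ### Squares in `ℤ_2`: units `≡ 1 (mod 8)` are squares -/

/-- **`u ≡ 1 (mod 8)` implies `u` is a square in `ℤ_2`** (Serre, *A Course in Arithmetic*, Ch. II
§3.3 Thm. 4): Hensel's lemma (Mathlib `hensels_lemma`) for `X² - u` at `1`:
`‖1 - u‖ ≤ 2⁻³ < ‖2‖² = 2⁻²`. [cite: Serre1973, Ch. II §3.3 Thm. 4] -/
theorem isSquare_of_toZModPow_three_eq_one (hp : p = 2) {u : ℤ_[p]}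
    (hu : PadicInt.toZModPow 3 u = 1) : IsSquare u := by
  subst hp
  set F : Polynomial ℤ_[2] := X ^ 2 - C u with hF
  have hF1 : F.aeval (1 : ℤ_[2]) = 1 - u := by
    simp [hF]
  have hF2 : F.derivative.aeval (1 : ℤ_[2]) = 2 := by
    simp [hF]
    norm_num
  have hmem : 1 - u ∈ (Ideal.span {(2 : ℤ_[2]) ^ 3} : Ideal ℤ_[2]) := by
    have : 1 - u ∈ RingHom.ker (PadicInt.toZModPow 3 : ℤ_[2] →+* ZMod (2 ^ 3)) := by
      rw [RingHom.mem_ker, map_sub, map_one, hu, sub_self]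
    rwa [PadicInt.ker_toZModPow] at this
  have hnorm1 : ‖F.aeval (1 : ℤ_[2])‖ ≤ (2 : ℝ) ^ (-3 : ℤ) := by
    rw [hF1]
    exact_mod_cast (PadicInt.norm_le_pow_iff_mem_span_pow (1 - u) 3).2 hmem
  have hnorm2 : ‖F.derivative.aeval (1 : ℤ_[2])‖ = (2 : ℝ)⁻¹ := by
    rw [hF2]
    exact_mod_cast PadicInt.norm_p (p := 2)
  have hnorm : ‖F.aeval (1 : ℤ_[2])‖ < ‖F.derivative.aeval (1 : ℤ_[2])‖ ^ 2 := by
    rw [hnorm2]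
    refine lt_of_le_of_lt hnorm1 ?_
    norm_num
  obtain ⟨z, hz, -⟩ := hensels_lemma hnorm
  refine ⟨z, ?_⟩
  have : z ^ 2 - u = 0 := by simpa [hF] using hz
  rw [← sq]
  exact (sub_eq_zero.1 this).symm

/-- An integer `t ≡ 1 (mod 8)` is a non-zero square in `ℤ_2`. [cite: Serre1973, Ch. II §3.3 Thm. 4] -/
theorem exists_sq_eq_intCast_of_mod_eight (hp : p = 2) {t : ℤ} (ht : t % 8 = 1) :
    ∃ z : ℤ_[p], z ≠ 0 ∧ z * z = (t : ℤ_[p]) := by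
  have hsq : IsSquare ((t : ℤ_[p])) := by
    refine isSquare_of_toZModPow_three_eq_one hp ?_
    subst hp
    rw [map_intCast]
    have : (t : ZMod (2 ^ 3)) = ((1 : ℤ) : ZMod (2 ^ 3)) := by
      rw [ZMod.intCast_eq_intCast_iff']
      norm_num [ht]
    rw [this, Int.cast_one]
  obtain ⟨z, hz⟩ := hsq
  refine ⟨z, ?_, hz.symm⟩
  rintro rfl
  rw [mul_zero] at hz
  have h0 : (t : ℤ_[p]) = 0 := hz
  have : (t : ℤ) = 0 := by exact_mod_cast h0
  omega

/-! ### Witnesses: `A x₀² + B y₀² ≡ 1 (mod 8)` gives `(A, B)_2 = 1` -/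

/-- If `A x₀² + B y₀² ≡ 1 (mod 8)` for some integers `x₀ y₀`, then `(A, B)_2 = 1` in `ℚ_2`: the
left-hand side is a square `z²` in `ℤ_2`, and `A (x₀/z)² + B (y₀/z)² = 1` (Serre's lifting step in
the proof of III Thm. 1, `p = 2`). [cite: Serre1973, Ch. III §1.2 Thm. 1 (p = 2)] -/
theorem hilbertSymbol_padic_eq_one_of_witness (hp : p = 2) (A B x₀ y₀ : ℤ)
    (h : (A * (x₀ * x₀) + B * (y₀ * y₀)) % 8 = 1) :
    hilbertSymbol ℚ_[p] (A : ℚ_[p]) (B : ℚ_[p]) = 1 := by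
  have h' : (A * x₀ ^ 2 + B * y₀ ^ 2) % 8 = 1 := by rw [sq, sq]; exact h
  obtain ⟨z, hz0, hz⟩ := exists_sq_eq_intCast_of_mod_eight hp h'
  rw [hilbertSymbol_eq_one_iff]
  refine ⟨(x₀ : ℚ_[p]) / (z : ℚ_[p]), (y₀ : ℚ_[p]) / (z : ℚ_[p]), ?_⟩
  have hz0' : (z : ℚ_[p]) ≠ 0 := PadicInt.coe_ne_zero.2 hz0
  have hz' : (z : ℚ_[p]) * (z : ℚ_[p]) = ((A * x₀ ^ 2 + B * y₀ ^ 2 : ℤ) : ℚ_[p]) := by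
    rw [← PadicInt.coe_mul, hz]; simp
  field_simp
  push_cast at hz' ⊢
  linear_combination (-1 : ℚ_[p]) * hz'

/-! ### Descent: no solution from congruence obstructions mod `8` and mod `4` -/

/-- Clearing denominators in `ℚ_p`: some power of `p` times `x` is a `p`-adic integer. [folklore] -/
theorem exists_pow_mul_mem_padicInt (x : ℚ_[p]) : ∃ (n : ℕ) (X : ℤ_[p]), (X : ℚ_[p]) = (p : ℚ_[p]) ^ n * x := by
  by_cases hx : x = 0
  · exact ⟨0, 0, by simp [hx]⟩
  have hn := Padic.norm_eq_zpow_neg_valuation hx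
  refine ⟨(-x.valuation).toNat, ⟨(p : ℚ_[p]) ^ (-x.valuation).toNat * x, ?_⟩, rfl⟩
  rw [norm_mul, norm_pow, Padic.norm_p, hn, inv_pow, ← zpow_natCast, ← zpow_neg, ← zpow_add₀]
  · have hp1 : (1 : ℝ) ≤ p := by exact_mod_cast hp2.out.one_lt.le
    calc (p : ℝ) ^ (-((-x.valuation).toNat : ℤ) + -x.valuation) ≤ (p : ℝ) ^ (0 : ℤ) := by
          apply zpow_le_zpow_right₀ hp1
          omega
      _ = 1 := zpow_zero _
  · exact_mod_cast hp2.out.ne_zero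

/-- **Descent**: if `A x² + B y² ≡ 1 (mod 8)` has no solution and `A x² + B y² ≡ 0 (mod 4)` forces
`x, y` even, then `A x² + B y² = 1` has no solution in `ℚ_2`, i.e. `(A, B)_2 = -1` (clear
denominators to `A X² + B Y² = 4ⁿ` in `ℤ_2` and descend on `n`; Serre's primitive-solution
argument in the proof of III Thm. 1, `p = 2`). [cite: Serre1973, Ch. III §1.2 Thm. 1 (p = 2)] -/
theorem hilbertSymbol_padic_eq_neg_one_of_mod (hp : p = 2) (A B : ℤ)
    (h8 : ∀ x y : ZMod 8, (A : ZMod 8) * x ^ 2 + (B : ZMod 8) * y ^ 2 ≠ 1)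
    (h4 : ∀ x y : ZMod 4, (A : ZMod 4) * x ^ 2 + (B : ZMod 4) * y ^ 2 = 0 →
      (x = 0 ∨ x = 2) ∧ (y = 0 ∨ y = 2)) :
    hilbertSymbol ℚ_[p] (A : ℚ_[p]) (B : ℚ_[p]) = -1 := by
  subst hp
  -- the descent in `ℤ_2`
  have hdesc : ∀ n : ℕ, ¬ ∃ X Y : ℤ_[2], (A : ℤ_[2]) * X ^ 2 + (B : ℤ_[2]) * Y ^ 2 = 4 ^ n := by
    intro n
    induction n with
    | zero =>
      rintro ⟨X, Y, hXY⟩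
      apply h8 (PadicInt.toZModPow 3 X) (PadicInt.toZModPow 3 Y)
      have := congrArg (PadicInt.toZModPow 3) hXY
      simp only [map_add, map_mul, map_pow, map_intCast, pow_zero, map_one] at this
      exact this
    | succ n ih =>
      rintro ⟨X, Y, hXY⟩
      apply ih
      -- reduce mod 4: both `X` and `Y` are even
      have hmod := congrArg (PadicInt.toZModPow 2) hXY
      simp only [map_add, map_mul, map_pow, map_intCast, map_ofNat] at hmod
      have h40 : (4 : ZMod (2 ^ 2)) ^ (n + 1) = 0 := by
        rw [show (4 : ZMod (2 ^ 2)) = 0 by decide]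
        exact zero_pow (Nat.succ_ne_zero n)
      rw [h40] at hmod
      obtain ⟨hX, hY⟩ := h4 _ _ hmod
      -- evenness in `ℤ_2`
      have heven : ∀ Z : ℤ_[2], (PadicInt.toZModPow 2 Z = 0 ∨ PadicInt.toZModPow 2 Z = 2) →
          ∃ Z' : ℤ_[2], Z = 2 * Z' := by
        intro Z hZ
        have hker : ∀ W : ℤ_[2], PadicInt.toZModPow 2 W = 0 → ∃ W' : ℤ_[2], W = 2 * W' := by
          intro W hW
          have hmem : W ∈ RingHom.ker (PadicInt.toZModPow 2 : ℤ_[2] →+* ZMod (2 ^ 2)) := hW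
          rw [PadicInt.ker_toZModPow, Ideal.mem_span_singleton] at hmem
          obtain ⟨c, hc⟩ := hmem
          exact ⟨2 * c, by rw [hc]; ring⟩
        rcases hZ with hZ | hZ
        · exact hker Z hZ
        · obtain ⟨W', hW'⟩ := hker (Z - 2) (by rw [map_sub, hZ, map_ofNat, sub_self])
          exact ⟨W' + 1, by linear_combination hW'⟩
      obtain ⟨X', rfl⟩ := heven X hX
      obtain ⟨Y', rfl⟩ := heven Y hY
      refine ⟨X', Y', ?_⟩
      have h4 : (4 : ℤ_[2]) ≠ 0 := by norm_num
      apply mul_left_cancel₀ h4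
      rw [pow_succ'] at hXY
      linear_combination hXY
  -- no solution in `ℚ_2`
  rw [← hilbertSymbol_ne_one_iff, Ne, hilbertSymbol_eq_one_iff]
  rintro ⟨x, y, hxy⟩
  obtain ⟨m, X₀, hX₀⟩ := exists_pow_mul_mem_padicInt (p := 2) x
  obtain ⟨k, Y₀, hY₀⟩ := exists_pow_mul_mem_padicInt (p := 2) y
  -- common denominator `2^(m+k)`
  refine hdesc (m + k) ⟨X₀ * (2 : ℤ_[2]) ^ k, Y₀ * (2 : ℤ_[2]) ^ m, PadicInt.ext ?_⟩
  have c2 : ((2 : ℤ_[2]) : ℚ_[2]) = 2 := by exact_mod_cast PadicInt.coe_natCast (p := 2) 2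
  have c4 : ((4 : ℤ_[2]) : ℚ_[2]) = 4 := by exact_mod_cast PadicInt.coe_natCast (p := 2) 4
  have n2 : ((2 : ℕ) : ℚ_[2]) = 2 := by norm_num
  push_cast
  simp only [c2, c4, hX₀, hY₀, n2]
  rw [show (4 : ℚ_[2]) = 2 ^ 2 by norm_num, ← pow_mul]
  linear_combination (2 : ℚ_[2]) ^ (2 * (m + k)) * hxy

/-! ### Residues of odd integers -/

omit hp2 in
/-- An odd integer is `≡ 1, 3, 5` or `7 (mod 8)`. [folklore] -/
theorem mod_eight_of_odd {u : ℤ} (hu : Odd u) : u % 8 = 1 ∨ u % 8 = 3 ∨ u % 8 = 5 ∨ u % 8 = 7 := by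
  have := Int.odd_iff.1 hu
  omega

omit hp2 in
/-- Cast of an integer to `ZMod 8` from its residue. [folklore] -/
theorem zmod8_eq_of_mod {u : ℤ} {r : ℕ} (h : u % 8 = r) : (u : ZMod 8) = r := by
  rw [← ZMod.intCast_mod u 8]
  norm_num [h]

omit hp2 in
/-- Cast of an integer to `ZMod 4` from its residue mod `8`. [folklore] -/
theorem zmod4_eq_of_mod {u : ℤ} {r : ℕ} (h : u % 8 = r) : (u : ZMod 4) = ((r % 4 : ℕ) : ZMod 4) := by
  rw [← ZMod.intCast_mod u 4]
  have : u % ((4 : ℕ) : ℤ) = ((r % 4 : ℕ) : ℤ) := by push_cast; omega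
  rw [this]
  norm_cast

/-- **`(u, w)_2` for odd integers** (Serre III Thm. 1, `p = 2`, `α = β = 0`): `(u, w)_2 = 1` iff
`u ≡ 1` or `w ≡ 1 (mod 4)`, i.e. `(u, w)_2 = (-1)^{ε(u) ε(w)} = epsSign u w`. Sixteen residue
cases mod `8`: a witness `u x₀² + w y₀² ≡ 1 (mod 8)` with `x₀, y₀ ∈ {0, 1, 2}` when the sign is
`+1` (`u ≡ 1 (8)`: `(1,0)`; `u ≡ 5 (8)`: `(1,2)`), the congruence obstruction mod `8`/`4` when
`u ≡ w ≡ 3 (mod 4)`. [cite: Serre1973, Ch. III §1.2 Thm. 1 (p = 2)] -/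
theorem hilbertSymbol_padic_odd_odd (hp : p = 2) {u w : ℤ} (hu : Odd u) (hw : Odd w) :
    hilbertSymbol ℚ_[p] (u : ℚ_[p]) (w : ℚ_[p]) = epsSign u w := by
  rcases mod_eight_of_odd hu with hr | hr | hr | hr <;>
    rcases mod_eight_of_odd hw with hs | hs | hs | hs
  · have e : epsSign u w = 1 := by
      unfold epsSign; rw [zmod4_eq_of_mod hr, zmod4_eq_of_mod hs]; decide
    rw [e]
    exact hilbertSymbol_padic_eq_one_of_witness hp u w 1 0 (by omega)
  · have e : epsSign u w = 1 := by
      unfold epsSign; rw [zmod4_eq_of_mod hr, zmod4_eq_of_mod hs]; decide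
    rw [e]
    exact hilbertSymbol_padic_eq_one_of_witness hp u w 1 0 (by omega)
  · have e : epsSign u w = 1 := by
      unfold epsSign; rw [zmod4_eq_of_mod hr, zmod4_eq_of_mod hs]; decide
    rw [e]
    exact hilbertSymbol_padic_eq_one_of_witness hp u w 1 0 (by omega)
  · have e : epsSign u w = 1 := by
      unfold epsSign; rw [zmod4_eq_of_mod hr, zmod4_eq_of_mod hs]; decide
    rw [e]
    exact hilbertSymbol_padic_eq_one_of_witness hp u w 1 0 (by omega)
  · have e : epsSign u w = 1 := by
      unfold epsSign; rw [zmod4_eq_of_mod hr, zmod4_eq_of_mod hs]; decide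
    rw [e]
    exact hilbertSymbol_padic_eq_one_of_witness hp u w 0 1 (by omega)
  · have e : epsSign u w = -1 := by
      unfold epsSign; rw [zmod4_eq_of_mod hr, zmod4_eq_of_mod hs]; decide
    rw [e]
    exact hilbertSymbol_padic_eq_neg_one_of_mod hp u w
      (by rw [zmod8_eq_of_mod hr, zmod8_eq_of_mod hs]; decide)
      (by rw [show ((u : ℤ) : ZMod 4) = ((3 % 4 : ℕ) : ZMod 4) from zmod4_eq_of_mod hr,
        show ((w : ℤ) : ZMod 4) = ((3 % 4 : ℕ) : ZMod 4) from zmod4_eq_of_mod hs]; decide)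
  · have e : epsSign u w = 1 := by
      unfold epsSign; rw [zmod4_eq_of_mod hr, zmod4_eq_of_mod hs]; decide
    rw [e]
    exact hilbertSymbol_padic_eq_one_of_witness hp u w 2 1 (by omega)
  · have e : epsSign u w = -1 := by
      unfold epsSign; rw [zmod4_eq_of_mod hr, zmod4_eq_of_mod hs]; decide
    rw [e]
    exact hilbertSymbol_padic_eq_neg_one_of_mod hp u w
      (by rw [zmod8_eq_of_mod hr, zmod8_eq_of_mod hs]; decide)
      (by rw [show ((u : ℤ) : ZMod 4) = ((3 % 4 : ℕ) : ZMod 4) from zmod4_eq_of_mod hr,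
        show ((w : ℤ) : ZMod 4) = ((7 % 4 : ℕ) : ZMod 4) from zmod4_eq_of_mod hs]; decide)
  · have e : epsSign u w = 1 := by
      unfold epsSign; rw [zmod4_eq_of_mod hr, zmod4_eq_of_mod hs]; decide
    rw [e]
    exact hilbertSymbol_padic_eq_one_of_witness hp u w 1 2 (by omega)
  · have e : epsSign u w = 1 := by
      unfold epsSign; rw [zmod4_eq_of_mod hr, zmod4_eq_of_mod hs]; decide
    rw [e]
    exact hilbertSymbol_padic_eq_one_of_witness hp u w 1 2 (by omega)
  · have e : epsSign u w = 1 := by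
      unfold epsSign; rw [zmod4_eq_of_mod hr, zmod4_eq_of_mod hs]; decide
    rw [e]
    exact hilbertSymbol_padic_eq_one_of_witness hp u w 1 2 (by omega)
  · have e : epsSign u w = 1 := by
      unfold epsSign; rw [zmod4_eq_of_mod hr, zmod4_eq_of_mod hs]; decide
    rw [e]
    exact hilbertSymbol_padic_eq_one_of_witness hp u w 1 2 (by omega)
  · have e : epsSign u w = 1 := by
      unfold epsSign; rw [zmod4_eq_of_mod hr, zmod4_eq_of_mod hs]; decide
    rw [e]
    exact hilbertSymbol_padic_eq_one_of_witness hp u w 0 1 (by omega)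
  · have e : epsSign u w = -1 := by
      unfold epsSign; rw [zmod4_eq_of_mod hr, zmod4_eq_of_mod hs]; decide
    rw [e]
    exact hilbertSymbol_padic_eq_neg_one_of_mod hp u w
      (by rw [zmod8_eq_of_mod hr, zmod8_eq_of_mod hs]; decide)
      (by rw [show ((u : ℤ) : ZMod 4) = ((7 % 4 : ℕ) : ZMod 4) from zmod4_eq_of_mod hr,
        show ((w : ℤ) : ZMod 4) = ((3 % 4 : ℕ) : ZMod 4) from zmod4_eq_of_mod hs]; decide)
  · have e : epsSign u w = 1 := by
      unfold epsSign; rw [zmod4_eq_of_mod hr, zmod4_eq_of_mod hs]; decide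
    rw [e]
    exact hilbertSymbol_padic_eq_one_of_witness hp u w 2 1 (by omega)
  · have e : epsSign u w = -1 := by
      unfold epsSign; rw [zmod4_eq_of_mod hr, zmod4_eq_of_mod hs]; decide
    rw [e]
    exact hilbertSymbol_padic_eq_neg_one_of_mod hp u w
      (by rw [zmod8_eq_of_mod hr, zmod8_eq_of_mod hs]; decide)
      (by rw [show ((u : ℤ) : ZMod 4) = ((7 % 4 : ℕ) : ZMod 4) from zmod4_eq_of_mod hr,
        show ((w : ℤ) : ZMod 4) = ((7 % 4 : ℕ) : ZMod 4) from zmod4_eq_of_mod hs]; decide)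

/-- **`(2u, w)_2` for odd integers** (Serre III Thm. 1, `p = 2`, `α = 1, β = 0`):
`(2u, w)_2 = (-1)^{ε(u) ε(w) + ω(w)} = epsSign u w · χ₈ w`. Sixteen residue cases mod `8`:
witnesses `2u x₀² + w y₀² ≡ 1 (mod 8)` (`w ≡ 1`: `(0,1)`; `w ≡ 7, u ≡ 1 (4)` and `w ≡ 3, u ≡ 3 (4)`:
`(1,1)`), obstruction mod `8` otherwise (`w ≡ 1 - 2u x²` forces the listed classes).
[cite: Serre1973, Ch. III §1.2 Thm. 1 (p = 2)] -/
theorem hilbertSymbol_padic_two_mul_odd (hp : p = 2) {u w : ℤ} (hu : Odd u) (hw : Odd w) :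
    hilbertSymbol ℚ_[p] ((2 * u : ℤ) : ℚ_[p]) (w : ℚ_[p]) = epsSign u w * ZMod.χ₈ (w : ZMod 8) := by
  rcases mod_eight_of_odd hu with hr | hr | hr | hr <;>
    rcases mod_eight_of_odd hw with hs | hs | hs | hs
  · have e : epsSign u w * ZMod.χ₈ (w : ZMod 8) = 1 := by
      unfold epsSign; rw [zmod4_eq_of_mod hr, zmod4_eq_of_mod hs, zmod8_eq_of_mod hs]; decide
    rw [e]
    have h2u : ((2 * u : ℤ) : ZMod 8) = ((2 * 1 : ℕ) : ZMod 8) := by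
      push_cast; rw [zmod8_eq_of_mod hr]; norm_num
    have h2u4 : ((2 * u : ℤ) : ZMod 4) = ((2 * 1 % 4 : ℕ) : ZMod 4) := by
      push_cast; rw [zmod4_eq_of_mod hr]; decide
    exact hilbertSymbol_padic_eq_one_of_witness hp (2 * u) w 0 1 (by omega)
  · have e : epsSign u w * ZMod.χ₈ (w : ZMod 8) = -1 := by
      unfold epsSign; rw [zmod4_eq_of_mod hr, zmod4_eq_of_mod hs, zmod8_eq_of_mod hs]; decide
    rw [e]
    have h2u : ((2 * u : ℤ) : ZMod 8) = ((2 * 1 : ℕ) : ZMod 8) := by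
      push_cast; rw [zmod8_eq_of_mod hr]; norm_num
    have h2u4 : ((2 * u : ℤ) : ZMod 4) = ((2 * 1 % 4 : ℕ) : ZMod 4) := by
      push_cast; rw [zmod4_eq_of_mod hr]; decide
    exact hilbertSymbol_padic_eq_neg_one_of_mod hp (2 * u) w
      (by rw [h2u, zmod8_eq_of_mod hs]; decide)
      (by rw [h2u4, show ((w : ℤ) : ZMod 4) = ((3 % 4 : ℕ) : ZMod 4) from zmod4_eq_of_mod hs]; decide)
  · have e : epsSign u w * ZMod.χ₈ (w : ZMod 8) = -1 := by
      unfold epsSign; rw [zmod4_eq_of_mod hr, zmod4_eq_of_mod hs, zmod8_eq_of_mod hs]; decide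
    rw [e]
    have h2u : ((2 * u : ℤ) : ZMod 8) = ((2 * 1 : ℕ) : ZMod 8) := by
      push_cast; rw [zmod8_eq_of_mod hr]; norm_num
    have h2u4 : ((2 * u : ℤ) : ZMod 4) = ((2 * 1 % 4 : ℕ) : ZMod 4) := by
      push_cast; rw [zmod4_eq_of_mod hr]; decide
    exact hilbertSymbol_padic_eq_neg_one_of_mod hp (2 * u) w
      (by rw [h2u, zmod8_eq_of_mod hs]; decide)
      (by rw [h2u4, show ((w : ℤ) : ZMod 4) = ((5 % 4 : ℕ) : ZMod 4) from zmod4_eq_of_mod hs]; decide)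
  · have e : epsSign u w * ZMod.χ₈ (w : ZMod 8) = 1 := by
      unfold epsSign; rw [zmod4_eq_of_mod hr, zmod4_eq_of_mod hs, zmod8_eq_of_mod hs]; decide
    rw [e]
    have h2u : ((2 * u : ℤ) : ZMod 8) = ((2 * 1 : ℕ) : ZMod 8) := by
      push_cast; rw [zmod8_eq_of_mod hr]; norm_num
    have h2u4 : ((2 * u : ℤ) : ZMod 4) = ((2 * 1 % 4 : ℕ) : ZMod 4) := by
      push_cast; rw [zmod4_eq_of_mod hr]; decide
    exact hilbertSymbol_padic_eq_one_of_witness hp (2 * u) w 1 1 (by omega)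
  · have e : epsSign u w * ZMod.χ₈ (w : ZMod 8) = 1 := by
      unfold epsSign; rw [zmod4_eq_of_mod hr, zmod4_eq_of_mod hs, zmod8_eq_of_mod hs]; decide
    rw [e]
    have h2u : ((2 * u : ℤ) : ZMod 8) = ((2 * 3 : ℕ) : ZMod 8) := by
      push_cast; rw [zmod8_eq_of_mod hr]; norm_num
    have h2u4 : ((2 * u : ℤ) : ZMod 4) = ((2 * 3 % 4 : ℕ) : ZMod 4) := by
      push_cast; rw [zmod4_eq_of_mod hr]; decide
    exact hilbertSymbol_padic_eq_one_of_witness hp (2 * u) w 0 1 (by omega)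
  · have e : epsSign u w * ZMod.χ₈ (w : ZMod 8) = 1 := by
      unfold epsSign; rw [zmod4_eq_of_mod hr, zmod4_eq_of_mod hs, zmod8_eq_of_mod hs]; decide
    rw [e]
    have h2u : ((2 * u : ℤ) : ZMod 8) = ((2 * 3 : ℕ) : ZMod 8) := by
      push_cast; rw [zmod8_eq_of_mod hr]; norm_num
    have h2u4 : ((2 * u : ℤ) : ZMod 4) = ((2 * 3 % 4 : ℕ) : ZMod 4) := by
      push_cast; rw [zmod4_eq_of_mod hr]; decide
    exact hilbertSymbol_padic_eq_one_of_witness hp (2 * u) w 1 1 (by omega)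
  · have e : epsSign u w * ZMod.χ₈ (w : ZMod 8) = -1 := by
      unfold epsSign; rw [zmod4_eq_of_mod hr, zmod4_eq_of_mod hs, zmod8_eq_of_mod hs]; decide
    rw [e]
    have h2u : ((2 * u : ℤ) : ZMod 8) = ((2 * 3 : ℕ) : ZMod 8) := by
      push_cast; rw [zmod8_eq_of_mod hr]; norm_num
    have h2u4 : ((2 * u : ℤ) : ZMod 4) = ((2 * 3 % 4 : ℕ) : ZMod 4) := by
      push_cast; rw [zmod4_eq_of_mod hr]; decide
    exact hilbertSymbol_padic_eq_neg_one_of_mod hp (2 * u) w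
      (by rw [h2u, zmod8_eq_of_mod hs]; decide)
      (by rw [h2u4, show ((w : ℤ) : ZMod 4) = ((5 % 4 : ℕ) : ZMod 4) from zmod4_eq_of_mod hs]; decide)
  · have e : epsSign u w * ZMod.χ₈ (w : ZMod 8) = -1 := by
      unfold epsSign; rw [zmod4_eq_of_mod hr, zmod4_eq_of_mod hs, zmod8_eq_of_mod hs]; decide
    rw [e]
    have h2u : ((2 * u : ℤ) : ZMod 8) = ((2 * 3 : ℕ) : ZMod 8) := by
      push_cast; rw [zmod8_eq_of_mod hr]; norm_num
    have h2u4 : ((2 * u : ℤ) : ZMod 4) = ((2 * 3 % 4 : ℕ) : ZMod 4) := by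
      push_cast; rw [zmod4_eq_of_mod hr]; decide
    exact hilbertSymbol_padic_eq_neg_one_of_mod hp (2 * u) w
      (by rw [h2u, zmod8_eq_of_mod hs]; decide)
      (by rw [h2u4, show ((w : ℤ) : ZMod 4) = ((7 % 4 : ℕ) : ZMod 4) from zmod4_eq_of_mod hs]; decide)
  · have e : epsSign u w * ZMod.χ₈ (w : ZMod 8) = 1 := by
      unfold epsSign; rw [zmod4_eq_of_mod hr, zmod4_eq_of_mod hs, zmod8_eq_of_mod hs]; decide
    rw [e]
    have h2u : ((2 * u : ℤ) : ZMod 8) = ((2 * 5 : ℕ) : ZMod 8) := by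
      push_cast; rw [zmod8_eq_of_mod hr]; norm_num
    have h2u4 : ((2 * u : ℤ) : ZMod 4) = ((2 * 5 % 4 : ℕ) : ZMod 4) := by
      push_cast; rw [zmod4_eq_of_mod hr]; decide
    exact hilbertSymbol_padic_eq_one_of_witness hp (2 * u) w 0 1 (by omega)
  · have e : epsSign u w * ZMod.χ₈ (w : ZMod 8) = -1 := by
      unfold epsSign; rw [zmod4_eq_of_mod hr, zmod4_eq_of_mod hs, zmod8_eq_of_mod hs]; decide
    rw [e]
    have h2u : ((2 * u : ℤ) : ZMod 8) = ((2 * 5 : ℕ) : ZMod 8) := by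
      push_cast; rw [zmod8_eq_of_mod hr]; norm_num
    have h2u4 : ((2 * u : ℤ) : ZMod 4) = ((2 * 5 % 4 : ℕ) : ZMod 4) := by
      push_cast; rw [zmod4_eq_of_mod hr]; decide
    exact hilbertSymbol_padic_eq_neg_one_of_mod hp (2 * u) w
      (by rw [h2u, zmod8_eq_of_mod hs]; decide)
      (by rw [h2u4, show ((w : ℤ) : ZMod 4) = ((3 % 4 : ℕ) : ZMod 4) from zmod4_eq_of_mod hs]; decide)
  · have e : epsSign u w * ZMod.χ₈ (w : ZMod 8) = -1 := by
      unfold epsSign; rw [zmod4_eq_of_mod hr, zmod4_eq_of_mod hs, zmod8_eq_of_mod hs]; decide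
    rw [e]
    have h2u : ((2 * u : ℤ) : ZMod 8) = ((2 * 5 : ℕ) : ZMod 8) := by
      push_cast; rw [zmod8_eq_of_mod hr]; norm_num
    have h2u4 : ((2 * u : ℤ) : ZMod 4) = ((2 * 5 % 4 : ℕ) : ZMod 4) := by
      push_cast; rw [zmod4_eq_of_mod hr]; decide
    exact hilbertSymbol_padic_eq_neg_one_of_mod hp (2 * u) w
      (by rw [h2u, zmod8_eq_of_mod hs]; decide)
      (by rw [h2u4, show ((w : ℤ) : ZMod 4) = ((5 % 4 : ℕ) : ZMod 4) from zmod4_eq_of_mod hs]; decide)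
  · have e : epsSign u w * ZMod.χ₈ (w : ZMod 8) = 1 := by
      unfold epsSign; rw [zmod4_eq_of_mod hr, zmod4_eq_of_mod hs, zmod8_eq_of_mod hs]; decide
    rw [e]
    have h2u : ((2 * u : ℤ) : ZMod 8) = ((2 * 5 : ℕ) : ZMod 8) := by
      push_cast; rw [zmod8_eq_of_mod hr]; norm_num
    have h2u4 : ((2 * u : ℤ) : ZMod 4) = ((2 * 5 % 4 : ℕ) : ZMod 4) := by
      push_cast; rw [zmod4_eq_of_mod hr]; decide
    exact hilbertSymbol_padic_eq_one_of_witness hp (2 * u) w 1 1 (by omega)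
  · have e : epsSign u w * ZMod.χ₈ (w : ZMod 8) = 1 := by
      unfold epsSign; rw [zmod4_eq_of_mod hr, zmod4_eq_of_mod hs, zmod8_eq_of_mod hs]; decide
    rw [e]
    have h2u : ((2 * u : ℤ) : ZMod 8) = ((2 * 7 : ℕ) : ZMod 8) := by
      push_cast; rw [zmod8_eq_of_mod hr]; norm_num
    have h2u4 : ((2 * u : ℤ) : ZMod 4) = ((2 * 7 % 4 : ℕ) : ZMod 4) := by
      push_cast; rw [zmod4_eq_of_mod hr]; decide
    exact hilbertSymbol_padic_eq_one_of_witness hp (2 * u) w 0 1 (by omega)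
  · have e : epsSign u w * ZMod.χ₈ (w : ZMod 8) = 1 := by
      unfold epsSign; rw [zmod4_eq_of_mod hr, zmod4_eq_of_mod hs, zmod8_eq_of_mod hs]; decide
    rw [e]
    have h2u : ((2 * u : ℤ) : ZMod 8) = ((2 * 7 : ℕ) : ZMod 8) := by
      push_cast; rw [zmod8_eq_of_mod hr]; norm_num
    have h2u4 : ((2 * u : ℤ) : ZMod 4) = ((2 * 7 % 4 : ℕ) : ZMod 4) := by
      push_cast; rw [zmod4_eq_of_mod hr]; decide
    exact hilbertSymbol_padic_eq_one_of_witness hp (2 * u) w 1 1 (by omega)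
  · have e : epsSign u w * ZMod.χ₈ (w : ZMod 8) = -1 := by
      unfold epsSign; rw [zmod4_eq_of_mod hr, zmod4_eq_of_mod hs, zmod8_eq_of_mod hs]; decide
    rw [e]
    have h2u : ((2 * u : ℤ) : ZMod 8) = ((2 * 7 : ℕ) : ZMod 8) := by
      push_cast; rw [zmod8_eq_of_mod hr]; norm_num
    have h2u4 : ((2 * u : ℤ) : ZMod 4) = ((2 * 7 % 4 : ℕ) : ZMod 4) := by
      push_cast; rw [zmod4_eq_of_mod hr]; decide
    exact hilbertSymbol_padic_eq_neg_one_of_mod hp (2 * u) w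
      (by rw [h2u, zmod8_eq_of_mod hs]; decide)
      (by rw [h2u4, show ((w : ℤ) : ZMod 4) = ((5 % 4 : ℕ) : ZMod 4) from zmod4_eq_of_mod hs]; decide)
  · have e : epsSign u w * ZMod.χ₈ (w : ZMod 8) = -1 := by
      unfold epsSign; rw [zmod4_eq_of_mod hr, zmod4_eq_of_mod hs, zmod8_eq_of_mod hs]; decide
    rw [e]
    have h2u : ((2 * u : ℤ) : ZMod 8) = ((2 * 7 : ℕ) : ZMod 8) := by
      push_cast; rw [zmod8_eq_of_mod hr]; norm_num
    have h2u4 : ((2 * u : ℤ) : ZMod 4) = ((2 * 7 % 4 : ℕ) : ZMod 4) := by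
      push_cast; rw [zmod4_eq_of_mod hr]; decide
    exact hilbertSymbol_padic_eq_neg_one_of_mod hp (2 * u) w
      (by rw [h2u, zmod8_eq_of_mod hs]; decide)
      (by rw [h2u4, show ((w : ℤ) : ZMod 4) = ((7 % 4 : ℕ) : ZMod 4) from zmod4_eq_of_mod hs]; decide)

/-! ### `(2u, 2w)_2` and the general formula -/

omit hp2 in
/-- For odd `u, w`: `epsSign u (-(u w)) = epsSign u w` (`ε(-1) = 1`, `ε(u)(1 + ε(u)) = 0`;
Serre's exponent manipulation in case 3 of the proof of III Thm. 1, `p = 2`). [folklore] -/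
theorem epsSign_neg_mul_self (u w : ℤ) (hu : Odd u) (hw : Odd w) :
    epsSign u (-(u * w)) = epsSign u w := by
  rcases mod_eight_of_odd hu with hr | hr | hr | hr <;>
    rcases mod_eight_of_odd hw with hs | hs | hs | hs <;>
  · unfold epsSign
    rw [Int.cast_neg, Int.cast_mul, zmod4_eq_of_mod hr, zmod4_eq_of_mod hs]
    decide

omit hp2 in
/-- For odd `u, w`: `χ₈ (-(u w)) = χ₈ u · χ₈ w` (`χ₈(-1) = 1`, `ω` is a homomorphism). [folklore] -/
theorem χ₈_neg_mul (u w : ℤ) :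
    ZMod.χ₈ ((-(u * w) : ℤ) : ZMod 8) = ZMod.χ₈ (u : ZMod 8) * ZMod.χ₈ (w : ZMod 8) := by
  rw [Int.cast_neg, Int.cast_mul, ← neg_one_mul, map_mul, map_mul]
  have : ZMod.χ₈ (-1 : ZMod 8) = 1 := by decide
  rw [this, one_mul]

/-- **`(2u, 2w)_2` for odd integers** (Serre III Thm. 1, `p = 2`, `α = β = 1`):
`(2u, 2w)_2 = (2u, -4uw)_2 = (2u, -uw)_2 = epsSign u w · χ₈ u · χ₈ w` (formula iv) of Serre's
Prop. 2, here `hilbertSymbol_neg_mul_right`, then the previous rule).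
[cite: Serre1973, Ch. III §1.2 Thm. 1 (p = 2)] -/
theorem hilbertSymbol_padic_two_mul_two_mul (hp : p = 2) {u w : ℤ} (hu : Odd u) (hw : Odd w) :
    hilbertSymbol ℚ_[p] ((2 * u : ℤ) : ℚ_[p]) ((2 * w : ℤ) : ℚ_[p]) =
      epsSign u w * ZMod.χ₈ (u : ZMod 8) * ZMod.χ₈ (w : ZMod 8) := by
  have h2u0 : ((2 * u : ℤ) : ℚ_[p]) ≠ 0 := by
    have : (2 * u : ℤ) ≠ 0 := by
      have := Int.odd_iff.1 hu; omega
    exact_mod_cast this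
  have huw : Odd (-(u * w)) := (hu.mul hw).neg
  -- `(2u, 2w) = (2u, -(2u · 2w)) = (2u, -(u w) · 2²) = (2u, -(u w))`
  rw [← hilbertSymbol_neg_mul_right h2u0 ((2 * w : ℤ) : ℚ_[p]),
    show -(((2 * u : ℤ) : ℚ_[p]) * ((2 * w : ℤ) : ℚ_[p])) = ((-(u * w) : ℤ) : ℚ_[p]) * 2 ^ 2 by
      push_cast; ring,
    hilbertSymbol_mul_sq_right _ _ (two_ne_zero' ℚ_[p]),
    hilbertSymbol_padic_two_mul_odd hp hu huw, epsSign_neg_mul_self u w hu hw, χ₈_neg_mul]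
  ring

/-- **Serre's evaluation of the `2`-adic Hilbert symbol of non-zero integers** (*A Course in
Arithmetic*, Ch. III §1.2 Thm. 1, `p = 2`): for `a = 2^α u`, `b = 2^β w` (`u, w` odd),
`(a, b)_2 = (-1)^{ε(u) ε(w) + α ω(w) + β ω(u)} = localSignTwo a b` in `ℚ_2` (written `ℚ_[p]` with
`p = 2`). Reduce `α, β` mod `2` by square classes and apply the three rules above.
[cite: Serre1973, Ch. III §1.2 Thm. 1 (p = 2)] -/
theorem hilbertSymbol_padic_eq_localSignTwo (hp : p = 2) {a b : ℤ} (ha : a ≠ 0) (hb : b ≠ 0) :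
    hilbertSymbol ℚ_[p] (a : ℚ_[p]) (b : ℚ_[p]) = localSignTwo a b := by
  haveI : Fact (Nat.Prime 2) := ⟨Nat.prime_two⟩
  set α := padicValInt 2 a with hα
  set β := padicValInt 2 b with hβ
  set u := primeCompl 2 a with hu
  set w := primeCompl 2 b with hw
  have huo : Odd u := odd_primeCompl_two ha
  have hwo : Odd w := odd_primeCompl_two hb
  have hχu := χ₈_eq_one_or_of_odd huo
  have hχw := χ₈_eq_one_or_of_odd hwo
  -- square-class reduction
  have hred : ∀ (n : ℤ), (n : ℚ_[p]) =
      (((2 : ℤ) ^ (padicValInt 2 n % 2) * primeCompl 2 n : ℤ) : ℚ_[p]) *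
        ((2 : ℚ_[p]) ^ (padicValInt 2 n / 2)) ^ 2 := by
    intro n
    conv_lhs => rw [← pow_padicValInt_mul_primeCompl 2 n, ← Nat.div_add_mod (padicValInt 2 n) 2]
    push_cast
    ring
  have h2 : (2 : ℚ_[p]) ≠ 0 := two_ne_zero
  rw [hred a, hred b, hilbertSymbol_mul_sq_left _ _ (pow_ne_zero _ h2),
    hilbertSymbol_mul_sq_right _ _ (pow_ne_zero _ h2)]
  simp only [← hα, ← hβ, ← hu, ← hw]
  unfold localSignTwo
  simp only [← hα, ← hβ, ← hu, ← hw]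
  rcases Nat.even_or_odd α with hαe | hαo <;> rcases Nat.even_or_odd β with hβe | hβo
  · simp only [Nat.even_iff.1 hαe, Nat.even_iff.1 hβe, pow_zero, one_mul]
    rw [hilbertSymbol_padic_odd_odd hp huo hwo, pow_eq_one_of_even_of_sign hχw hαe,
      pow_eq_one_of_even_of_sign hχu hβe]
    ring
  · simp only [Nat.even_iff.1 hαe, Nat.odd_iff.1 hβo, pow_zero, one_mul, pow_one]
    rw [hilbertSymbol_comm, hilbertSymbol_padic_two_mul_odd hp hwo huo, epsSign_comm,
      pow_eq_one_of_even_of_sign hχw hαe, pow_eq_self_of_odd_of_sign hχu hβo]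
    ring
  · simp only [Nat.odd_iff.1 hαo, Nat.even_iff.1 hβe, pow_zero, one_mul, pow_one]
    rw [hilbertSymbol_padic_two_mul_odd hp huo hwo, pow_eq_self_of_odd_of_sign hχw hαo,
      pow_eq_one_of_even_of_sign hχu hβe]
    ring
  · simp only [Nat.odd_iff.1 hαo, Nat.odd_iff.1 hβo, pow_one]
    rw [hilbertSymbol_padic_two_mul_two_mul hp huo hwo, pow_eq_self_of_odd_of_sign hχw hαo,
      pow_eq_self_of_odd_of_sign hχu hβo]
    ring

end Dyadic

/-! ### Transfer to the place of `ℚ` over `2` -/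

open IsDedekindDomain NumberField Rat.HeightOneSpectrum

/-- **The dyadic evaluation at the place of `ℚ` over `2`** (Serre III Thm. 1, `p = 2`): for the
finite place `v` of `ℚ` with `natGenerator v = 2` and non-zero integers `a b`, the Hilbert symbol
in `ℚ_v` is `localSignTwo a b`; transported from `ℚ_[2]` along Mathlib's
`adicCompletion.padicEquiv v : ℚ_v ≃A[ℚ] ℚ_[p]` (`hilbertSymbol_map_ringEquiv`).
[cite: Serre1973, Ch. III §1.2 Thm. 1 (p = 2)] -/
theorem hilbertSymbol_rat_eq_localSignTwo (v : HeightOneSpectrum (𝓞 ℚ)) (hv : natGenerator v = 2)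
    {a b : ℤ} (ha : a ≠ 0) (hb : b ≠ 0) :
    hilbertSymbol (v.adicCompletion ℚ) (algebraMap ℚ _ (a : ℚ)) (algebraMap ℚ _ (b : ℚ)) =
      localSignTwo a b := by
  haveI : Fact (primesEquiv (R := 𝓞 ℚ) v : ℕ).Prime := ⟨(primesEquiv (R := 𝓞 ℚ) v).2⟩
  let e := (adicCompletion.padicEquiv (R := 𝓞 ℚ) v).toAlgEquiv
  rw [← hilbertSymbol_map_ringEquiv e.toRingEquiv]
  have hea : ∀ q : ℚ, e.toRingEquiv (algebraMap ℚ (v.adicCompletion ℚ) q) = (q : ℚ_[primesEquiv v]) := by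
    intro q
    change e (algebraMap ℚ (v.adicCompletion ℚ) q) = _
    rw [AlgEquiv.commutes, eq_ratCast]
  rw [hea, hea, Rat.cast_intCast, Rat.cast_intCast]
  exact Dyadic.hilbertSymbol_padic_eq_localSignTwo (p := (primesEquiv (R := 𝓞 ℚ) v : ℕ)) hv ha hb



/-! ### The explicit local sign at every prime -/

/-- The explicit local sign at a prime `p`: Serre's dyadic formula at `p = 2`, the odd formula
otherwise. [cite: Serre1973, Ch. III §1.2 Thm. 1] -/
def localSign (p : ℕ) (a b : ℤ) : ℤ := if p = 2 then localSignTwo a b else localSignOdd p a b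

/-- **Serre III Thm. 1 for `ℚ` at every finite place**: the Hilbert symbol of two non-zero
integers at a finite place `v` of `ℚ` is the explicit sign at the prime under `v`
(`hilbertSymbol_rat_eq_localSignTwo` over `2`, `hilbertSymbol_rat_eq_localSignOdd` for odd primes).
[cite: Serre1973, Ch. III §1.2 Thm. 1] -/
theorem hilbertSymbol_rat_eq_localSign (v : HeightOneSpectrum (𝓞 ℚ))
    {a b : ℤ} (ha : a ≠ 0) (hb : b ≠ 0) :
    hilbertSymbol (v.adicCompletion ℚ) (algebraMap ℚ _ (a : ℚ)) (algebraMap ℚ _ (b : ℚ)) =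
      localSign (natGenerator v) a b := by
  unfold localSign
  split_ifs with h2
  · exact hilbertSymbol_rat_eq_localSignTwo v h2 ha hb
  · exact hilbertSymbol_rat_eq_localSignOdd v h2 ha hb

/-- At a prime not dividing `2 a b` the explicit sign is `1`. [folklore] -/
theorem localSign_eq_one_of_not_dvd {p : ℕ} (hp : p.Prime) {a b : ℤ} (h : ¬ (p : ℤ) ∣ 2 * a * b) :
    localSign p a b = 1 := by
  unfold localSign
  have hp2 : p ≠ 2 := by
    rintro rfl
    exact h (dvd_mul_of_dvd_left (dvd_mul_right 2 a) b)
  rw [if_neg hp2]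
  haveI := Fact.mk hp
  have ha : ¬ (p : ℤ) ∣ a := fun ha ↦ h (dvd_mul_of_dvd_left (dvd_mul_of_dvd_right ha 2) b)
  have hb : ¬ (p : ℤ) ∣ b := fun hb ↦ h (dvd_mul_of_dvd_right hb _)
  exact localSignOdd_of_not_dvd ha hb

/-! ### Counting `-1`'s: products of signs -/

/-- For a `±1`-valued function on a finset, `∏ f = (-1)^{#{f = -1}}`. [folklore] -/
theorem prod_eq_neg_one_pow_card_filter {ι : Type*} [DecidableEq ι] (s : Finset ι) (f : ι → ℤ)
    (hf : ∀ i ∈ s, f i = 1 ∨ f i = -1) :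
    ∏ i ∈ s, f i = (-1) ^ (s.filter fun i ↦ f i = -1).card := by
  induction s using Finset.induction_on with
  | empty => simp
  | insert i s hi ih =>
    rw [Finset.prod_insert hi, Finset.filter_insert, ih fun j hj ↦ hf j (Finset.mem_insert_of_mem hj)]
    rcases hf i (Finset.mem_insert_self i s) with h | h
    · rw [h, one_mul, if_neg (by norm_num)]
    · rw [h, if_pos rfl, Finset.card_insert_of_notMem (fun h' ↦ hi (Finset.mem_filter.1 h').1),
        pow_succ]
      ring

/-- A single sign as a power of `-1`: `s = (-1)^{[s = -1]}`. [folklore] -/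
theorem sign_eq_neg_one_pow_ite {x : ℤ} (hx : x = 1 ∨ x = -1) :
    x = (-1) ^ (if x = -1 then 1 else 0) := by
  rcases hx with rfl | rfl <;> simp

/-! ### Reduction to integers -/

/-- Every non-zero rational is a non-zero integer times a non-zero rational square:
`a · den(a)² = num(a) · den(a)`. [folklore] -/
theorem Rat.exists_mul_sq_eq_intCast {a : ℚ} (ha : a ≠ 0) :
    ∃ (A : ℤ) (c : ℚ), A ≠ 0 ∧ c ≠ 0 ∧ a * c ^ 2 = (A : ℚ) := by
  refine ⟨a.num * a.den, a.den, ?_, by exact_mod_cast a.den_ne_zero, ?_⟩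
  · exact mul_ne_zero (Rat.num_ne_zero.2 ha) (by exact_mod_cast a.den_ne_zero)
  · rw [sq, ← mul_assoc, Rat.mul_den_eq_num]
    push_cast
    ring

/-- The Hilbert symbol of `a, b ∈ ℚ` in any field extension `F ⊇ ℚ` only depends on integral
representatives of the square classes. [folklore] -/
theorem hilbertSymbol_algebraMap_rat_eq {F : Type*} [Field F] [Algebra ℚ F] {a b : ℚ} {A B : ℤ}
    {c d : ℚ} (hc : c ≠ 0) (hd : d ≠ 0) (hA : a * c ^ 2 = A) (hB : b * d ^ 2 = B) :
    hilbertSymbol F (algebraMap ℚ F a) (algebraMap ℚ F b) =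
      hilbertSymbol F (algebraMap ℚ F (A : ℚ)) (algebraMap ℚ F (B : ℚ)) := by
  rw [← hA, ← hB, map_mul, map_pow, map_mul, map_pow,
    hilbertSymbol_mul_sq_left _ _ ((_root_.map_ne_zero _).2 hc),
    hilbertSymbol_mul_sq_right _ _ ((_root_.map_ne_zero _).2 hd)]

/-! ### The finite places with symbol `-1`, as a set of primes -/

/-- The set of finite places of `ℚ` at which two non-zero integers have Hilbert symbol `-1` has the
same cardinality as the set of primes `p ∣ 2 A B` with explicit sign `localSign p A B = -1`
(transport along `v ↦ natGenerator v`, Mathlib `Rat.HeightOneSpectrum.primesEquiv`).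
[folklore] -/
theorem ncard_setOf_hilbertSymbol_finite_rat {A B : ℤ} (hA : A ≠ 0)
    (hB : B ≠ 0) :
    {v : HeightOneSpectrum (𝓞 ℚ) |
        hilbertSymbol (v.adicCompletion ℚ) (algebraMap ℚ _ (A : ℚ)) (algebraMap ℚ _ (B : ℚ)) = -1}.ncard
      = ((2 * A * B).natAbs.primeFactors.filter fun p ↦ localSign p A B = -1).card := by
  classical
  rw [← Set.ncard_coe_finset]
  refine Set.ncard_congr (fun v _ ↦ natGenerator v) (fun v hv ↦ ?_) (fun v w hv hw h ↦ ?_)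
    (fun p hp ↦ ?_)
  · -- maps into the finset
    rw [Set.mem_setOf_eq, hilbertSymbol_rat_eq_localSign v hA hB] at hv
    rw [Finset.coe_filter, Set.mem_setOf_eq, Nat.mem_primeFactors]
    refine ⟨⟨prime_natGenerator v, ?_, ?_⟩, hv⟩
    · by_contra hnd
      have hnd' : ¬ ((natGenerator v : ℕ) : ℤ) ∣ 2 * A * B := by
        intro h'
        exact hnd (by exact_mod_cast Int.natAbs_dvd_natAbs.2 h')
      rw [localSign_eq_one_of_not_dvd (prime_natGenerator v) hnd'] at hv
      norm_num at hv
    · exact Int.natAbs_ne_zero.2 (mul_ne_zero (mul_ne_zero two_ne_zero hA) hB)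
  · -- injective
    have h' : primesEquiv v = primesEquiv w := Subtype.ext h
    exact (primesEquiv (R := 𝓞 ℚ)).injective h'
  · -- surjective
    rw [Finset.coe_filter, Set.mem_setOf_eq, Nat.mem_primeFactors] at hp
    obtain ⟨⟨hpp, -, -⟩, hps⟩ := hp
    refine ⟨(primesEquiv (R := 𝓞 ℚ)).symm ⟨p, hpp⟩, ?_, ?_⟩
    · have hq : natGenerator ((primesEquiv (R := 𝓞 ℚ)).symm ⟨p, hpp⟩) = p :=
        congrArg Subtype.val ((primesEquiv (R := 𝓞 ℚ)).apply_symm_apply ⟨p, hpp⟩)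
      rw [Set.mem_setOf_eq, hilbertSymbol_rat_eq_localSign _ hA hB, hq]
      exact hps
    · exact congrArg Subtype.val ((primesEquiv (R := 𝓞 ℚ)).apply_symm_apply ⟨p, hpp⟩)

/-! ### Hilbert reciprocity over `ℚ` -/

/-- **Hilbert's reciprocity law over `ℚ`** (Hilbert 1897; Serre, *A Course in Arithmetic*,
Ch. III §2.1 Thm. 3) — discharge of the named fact `hilbertReciprocity` of `HilbertSymbol.lean`
for `K = ℚ`: for all `a b ∈ ℚ×` the Hilbert symbol `(a, b)_v` is `-1` at only finitely many
places and at an even number of places of `ℚ` (finite and infinite), i.e. `∏_v (a, b)_v = 1`. Proof: reduce to non-zero integers `A, B` (square classes);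
the places with symbol `-1` are the primes `p ∣ 2AB` with explicit sign `-1`
(`ncard_setOf_hilbertSymbol_finite_rat`, using III Thm. 1 at each prime) together with `∞` iff
`A, B < 0` (`ncard_setOf_hilbertSymbol_infinitePlace_rat`); their number is even because the
product of all explicit signs is `1` (`totalSign_eq_one`: bimultiplicativity, quadratic
reciprocity and its two supplements). [cite: Serre1973, Ch. III §2.1 Thm. 3] -/
theorem hilbertReciprocity_rat (a b : ℚ) : hilbertReciprocity ℚ a b := by
  classical
  intro ha hb
  refine ⟨finite_setOf_hilbertSymbol_eq_neg_one ℚ ha hb, ?_⟩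
  -- integral representatives
  obtain ⟨A, c, hA, hc, hAc⟩ := Rat.exists_mul_sq_eq_intCast ha
  obtain ⟨B, d, hB, hd, hBd⟩ := Rat.exists_mul_sq_eq_intCast hb
  have hfin : {v : HeightOneSpectrum (𝓞 ℚ) |
      hilbertSymbol (v.adicCompletion ℚ) (algebraMap ℚ _ a) (algebraMap ℚ _ b) = -1} =
      {v : HeightOneSpectrum (𝓞 ℚ) |
        hilbertSymbol (v.adicCompletion ℚ) (algebraMap ℚ _ (A : ℚ)) (algebraMap ℚ _ (B : ℚ)) = -1} := by
    ext v
    rw [Set.mem_setOf_eq, Set.mem_setOf_eq, hilbertSymbol_algebraMap_rat_eq hc hd hAc hBd]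
  have hinf : {w : InfinitePlace ℚ |
      hilbertSymbol w.Completion (algebraMap ℚ _ a) (algebraMap ℚ _ b) = -1} =
      {w : InfinitePlace ℚ |
        hilbertSymbol w.Completion (algebraMap ℚ _ (A : ℚ)) (algebraMap ℚ _ (B : ℚ)) = -1} := by
    ext w
    rw [Set.mem_setOf_eq, Set.mem_setOf_eq, hilbertSymbol_algebraMap_rat_eq hc hd hAc hBd]
  rw [hfin, hinf, ncard_setOf_hilbertSymbol_finite_rat hA hB,
    ncard_setOf_hilbertSymbol_infinitePlace_rat hA hB]
  -- the explicit product formula over the odd primes dividing `2 A B`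
  set P := (2 * A * B).natAbs.primeFactors with hP
  set S := P.erase 2 with hS
  have h2AB : (2 * A * B).natAbs ≠ 0 := Int.natAbs_ne_zero.2 (mul_ne_zero (mul_ne_zero two_ne_zero hA) hB)
  have hSprime : ∀ q ∈ S, q.Prime ∧ q ≠ 2 := fun q hq ↦
    ⟨Nat.prime_of_mem_primeFactors (Finset.mem_of_mem_erase hq), Finset.ne_of_mem_erase hq⟩
  have hmemS : ∀ (x : ℤ), x ∣ 2 * A * B → ∀ q : ℕ, q.Prime → q ≠ 2 → (q : ℤ) ∣ x → q ∈ S := by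
    intro x hx q hq hq2 hqx
    refine Finset.mem_erase.2 ⟨hq2, Nat.mem_primeFactors.2 ⟨hq, ?_, h2AB⟩⟩
    exact Int.natAbs_dvd_natAbs.2 (hqx.trans hx) |>.trans (by simp)
  have hprod := totalSign_eq_one S hSprime hA hB
    (hmemS A (dvd_mul_of_dvd_left (dvd_mul_left A 2) B))
    (hmemS B (dvd_mul_left B _))
  unfold totalSign at hprod
  -- rewrite every sign as a power of `-1`
  have h2P : 2 ∈ P := Nat.mem_primeFactors.2 ⟨Nat.prime_two, by
    rw [Int.natAbs_mul, Int.natAbs_mul]; exact dvd_mul_of_dvd_left (dvd_mul_right 2 _) _, h2AB⟩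
  have hsInf : localSignInfty A B = 1 ∨ localSignInfty A B = -1 := by
    unfold localSignInfty; split_ifs <;> simp
  have hsTwo : localSignTwo A B = 1 ∨ localSignTwo A B = -1 := by
    have h := hilbertSymbol_eq_one_or_eq_neg_one (F := ((primesEquiv (R := 𝓞 ℚ)).symm
      ⟨2, Nat.prime_two⟩).adicCompletion ℚ) (algebraMap ℚ _ (A : ℚ)) (algebraMap ℚ _ (B : ℚ))
    rwa [hilbertSymbol_rat_eq_localSignTwo _ (congrArg Subtype.val
      ((primesEquiv (R := 𝓞 ℚ)).apply_symm_apply ⟨2, Nat.prime_two⟩)) hA hB] at h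
  have hsOdd : ∀ q ∈ S, localSignOdd q A B = 1 ∨ localSignOdd q A B = -1 := by
    intro q hq
    haveI := Fact.mk (hSprime q hq).1
    have h := hilbertSymbol_eq_one_or_eq_neg_one (F := ((primesEquiv (R := 𝓞 ℚ)).symm
      ⟨q, (hSprime q hq).1⟩).adicCompletion ℚ) (algebraMap ℚ _ (A : ℚ)) (algebraMap ℚ _ (B : ℚ))
    have hq' : natGenerator ((primesEquiv (R := 𝓞 ℚ)).symm ⟨q, (hSprime q hq).1⟩) = q :=
      congrArg Subtype.val ((primesEquiv (R := 𝓞 ℚ)).apply_symm_apply ⟨q, (hSprime q hq).1⟩)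
    rwa [hilbertSymbol_rat_eq_localSignOdd _ (by rw [hq']; exact (hSprime q hq).2) hA hB, hq'] at h
  rw [prod_eq_neg_one_pow_card_filter S _ hsOdd, sign_eq_neg_one_pow_ite hsInf,
    sign_eq_neg_one_pow_ite hsTwo, ← pow_add, ← pow_add] at hprod
  have heven : Even ((if localSignInfty A B = -1 then 1 else 0) +
      (if localSignTwo A B = -1 then 1 else 0) + (S.filter fun q ↦ localSignOdd q A B = -1).card) := by
    by_contra hodd
    rw [Nat.not_even_iff_odd] at hodd
    rw [hodd.neg_one_pow] at hprod
    norm_num at hprod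
  -- identify the count over `P` with the count over `{2} ∪ S`
  have hcount : (P.filter fun p ↦ localSign p A B = -1).card =
      (if localSignTwo A B = -1 then 1 else 0) + (S.filter fun q ↦ localSignOdd q A B = -1).card := by
    have hS2 : 2 ∉ S := Finset.notMem_erase 2 P
    have hPS : P = insert 2 S := (Finset.insert_erase h2P).symm
    have hfilt : (S.filter fun p ↦ localSign p A B = -1) = S.filter fun q ↦ localSignOdd q A B = -1 :=
      Finset.filter_congr fun q hq ↦ by rw [localSign, if_neg (hSprime q hq).2]
    rw [hPS, Finset.filter_insert, hfilt]
    have h2 : localSign 2 A B = localSignTwo A B := by rw [localSign, if_pos rfl]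
    rw [h2]
    split_ifs with h
    · rw [Finset.card_insert_of_notMem (fun h' ↦ hS2 (Finset.mem_filter.1 h').1), add_comm]
    · rw [zero_add]
  rw [hcount]
  convert heven using 1
  ring

end Literature.NumberTheory.QuadraticForms
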